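import Literature.Computability.AlgebraicComplexity.BD17DescartesCircuits
import HarnessLib

/-!
# Bihan–Dickenstein 2017, Prop. 2.6: existence of an ordering — PROVED

F. Bihan, A. Dickenstein, *Descartes' rule of signs for polynomial systems supported on circuits*,
Int. Math. Res. Not. IMRN 2017 (22) 6867–6893 = arXiv:1601.05826 [BihanDickenstein2017], §2.2,
Prop. 2.6 (held text `paper:arxiv-1601.05826`, p0006:L72 "Proposition 6"). THEOREMS ONLY; sibling
of the statement file `BD17DescartesCircuits.lean` (cell `val-lit`, row X4-BD17), whose named fact
`BD2017_prop_2_6` is DISCHARGED here BY NAME (`BD2017_prop_2_6_holds`), not restated.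

The printed proof (p0006:L76–L100) is followed step by step:

* Lemma 2.3 (p0006:L28 "Lemma 3", the easy direction used in the proof): a positive kernel vector
  `u = B μ` of `C` (condition (1.5)) means that the Gale dual vectors `P_0, …, P_{n+1}` (the rows of
  `B`) lie in the open half-plane `⟨·, μ⟩ > 0` — here in coordinates: `u_j = a B_{j,0} + b B_{j,1} > 0`
  (`BD17.exists_coeffs_of_isGaleDual`).
* "We can thus order them according to their arguments" (p0006:L80): with a second kernel vector
  `u'` independent of `u` (it exists because `rk C = n` forces `dim ker C = 2`,
  `BD17.finrank_ker_mulVecLin_eq_two`, `BD17.exists_mem_ker_not_mem_span`), the permutation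
  `α = Tuple.sort (u'/u)` sorting the slopes `t_j = u'_j / u_j` satisfies
  `u_{α_i} u'_{α_j} − u'_{α_i} u_{α_j} ≥ 0` for `i < j`.
* "there is an invertible matrix `M ∈ ℝ^{2×2}` such that `B'·M = B` … if `det(Mᵗ) > 0` … and if
  `det(Mᵗ) < 0` …" (p0006:L88–L99): for ANY Gale dual `B` of `C`, writing `u = a b_0 + b b_1`,
  `u' = c b_0 + d b_1` in the columns `b_0, b_1` of `B`, one has the change-of-basis identity
  `u_i u'_j − u'_i u_j = (ad − bc) · det(P_i, P_j)` (`BD17.cross_eq_det_mul_galeDet`) with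
  `ad − bc ≠ 0` (`u, u'` independent), so `ε = sign(ad − bc) ∈ {1, −1}` works in Def. 2.5.

Honest framing: a typed-literature companion (LADDER-VALIANT V1 ideation source); nothing here bears
on VP versus VNP.

## References

* [BihanDickenstein2017] F. Bihan, A. Dickenstein, IMRN 2017 (22) 6867–6893; arXiv:1601.05826,
  §2.2 Lemma 2.3, Def. 2.5, Prop. 2.6.
-/

noncomputable section

open Matrix Finset

namespace Literature.Computability.AlgebraicComplexity

namespace BD17

variable {n : ℕ}

/-- Rank–nullity under `rk C = n`: the kernel of `C ∈ ℝ^{n×(n+2)}` is a plane ("the columns of `B`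
give a basis of `Ker(C)`", p0006:L90). [cite: BihanDickenstein2017, Prop. 2.6 (proof)] -/
theorem finrank_ker_mulVecLin_eq_two (C : Matrix (Fin n) (Fin (n + 2)) ℝ) (hrk : C.rank = n) :
    Module.finrank ℝ (LinearMap.ker C.mulVecLin) = 2 := by
  have h := LinearMap.finrank_range_add_finrank_ker C.mulVecLin
  rw [Module.finrank_fin_fun] at h
  have hr : Module.finrank ℝ (LinearMap.range C.mulVecLin) = n := hrk
  omega

/-- A second kernel vector, not a multiple of a given nonzero kernel vector (the kernel is a plane).
[cite: BihanDickenstein2017, Prop. 2.6 (proof)] -/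
theorem exists_mem_ker_not_mem_span (C : Matrix (Fin n) (Fin (n + 2)) ℝ) (hrk : C.rank = n)
    {u : Fin (n + 2) → ℝ} (hu0 : u ≠ 0) :
    ∃ u' : Fin (n + 2) → ℝ, C.mulVec u' = 0 ∧ u' ∉ Submodule.span ℝ {u} := by
  have h2 := finrank_ker_mulVecLin_eq_two C hrk
  by_contra h
  push Not at h
  have hle : LinearMap.ker C.mulVecLin ≤ Submodule.span ℝ {u} := fun v hv =>
    h v (by simpa using hv)
  have hmono := Submodule.finrank_mono hle
  rw [h2, finrank_span_singleton hu0] at hmono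
  omega

/-- A kernel vector of `C` is a combination of the two columns of any Gale dual matrix `B`:
`u_j = a B_{j,0} + b B_{j,1} = ⟨P_j, (a, b)⟩` ("Any vector `u` in the kernel of `C` is of the form
`B μ`", proof of Lemma 2.3, p0006:L34). [cite: BihanDickenstein2017, Lemma 2.3 (proof)] -/
theorem exists_coeffs_of_isGaleDual {C : Matrix (Fin n) (Fin (n + 2)) ℝ}
    {B : Matrix (Fin (n + 2)) (Fin 2) ℝ} (hB : IsGaleDual C B)
    {u : Fin (n + 2) → ℝ} (hu : C.mulVec u = 0) :
    ∃ a b : ℝ, ∀ j, u j = a * B j 0 + b * B j 1 := by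
  have huK : u ∈ LinearMap.ker C.mulVecLin := by simpa using hu
  rw [← hB, Submodule.mem_span_range_iff_exists_fun] at huK
  obtain ⟨c, hc⟩ := huK
  refine ⟨c 0, c 1, fun j => ?_⟩
  have := congr_fun hc j
  simp only [Finset.sum_apply, Pi.smul_apply, smul_eq_mul, Fin.sum_univ_two] at this
  rw [← this]

/-- The change-of-basis identity behind "each vector `P_i` equals the image of the vector `P'_i` by
the invertible linear map with matrix `Mᵗ`" (p0006:L91–L93): if `u = a b_0 + b b_1` and
`u' = c b_0 + d b_1` in the columns of `B`, then `u_i u'_j − u'_i u_j = (ad − bc) det(P_i, P_j)`.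
[cite: BihanDickenstein2017, Prop. 2.6 (proof)] -/
theorem cross_eq_det_mul_galeDet (B : Matrix (Fin (n + 2)) (Fin 2) ℝ) (a b c d : ℝ)
    {u u' : Fin (n + 2) → ℝ} (hu : ∀ j, u j = a * B j 0 + b * B j 1)
    (hu' : ∀ j, u' j = c * B j 0 + d * B j 1) (i j : Fin (n + 2)) :
    u i * u' j - u' i * u j = (a * d - b * c) * galeDet B i j := by
  rw [hu i, hu j, hu' i, hu' j, galeDet]
  ring

/-- Sorting by slope: for `u` positive and `α = Tuple.sort (u'/u)`, the cross terms
`u_{α_i} u'_{α_j} − u'_{α_i} u_{α_j}` are nonnegative for `i < j` ("We can thus order them according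
to their arguments", p0006:L80). [cite: BihanDickenstein2017, Prop. 2.6 (proof)] -/
theorem cross_nonneg_of_sort {u u' : Fin (n + 2) → ℝ} (hupos : ∀ j, 0 < u j)
    {i j : Fin (n + 2)} (hij : i ≤ j) :
    0 ≤ u (Tuple.sort (fun l => u' l / u l) i) * u' (Tuple.sort (fun l => u' l / u l) j) -
      u' (Tuple.sort (fun l => u' l / u l) i) * u (Tuple.sort (fun l => u' l / u l) j) := by
  set α := Tuple.sort (fun l => u' l / u l) with hα
  have hmono := Tuple.monotone_sort (fun l => u' l / u l) hij
  simp only [Function.comp_apply] at hmono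
  rw [div_le_div_iff₀ (hupos _) (hupos _)] at hmono
  linarith

end BD17

open BD17

/-- **BD 2017, Prop. 2.6 — DISCHARGED** (`theorem BD2017_prop_2_6_holds : BD2017_prop_2_6`): "Let
`C ∈ ℝ^{n×(n+2)}` be a full rank matrix satisfying (1.5). Then, there exists an ordering `α` of `C`."
Proof as printed (p0006:L76–L100): order the Gale dual vectors, which lie in an open half-plane, by
their arguments; any other Gale dual differs by an invertible `2 × 2` matrix `M`, and
`ε = sign det M`. [cite: BihanDickenstein2017, Prop. 2.6] -/
theorem BD2017_prop_2_6_holds : BD2017_prop_2_6 := by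
  intro n C hrk hcone
  obtain ⟨u, hupos, hu⟩ := hcone
  have hu0 : u ≠ 0 := by
    intro h
    have := hupos 0
    simp [h] at this
  obtain ⟨u', hu', hu'span⟩ := exists_mem_ker_not_mem_span C hrk hu0
  refine ⟨Tuple.sort (fun l => u' l / u l), fun B hB => ?_⟩
  obtain ⟨a, b, hab⟩ := exists_coeffs_of_isGaleDual hB hu
  obtain ⟨c, d, hcd⟩ := exists_coeffs_of_isGaleDual hB hu'
  -- the determinant of the change of basis is nonzero since `u, u'` are independent
  have hD0 : a * d - b * c ≠ 0 := by
    intro hD0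
    apply hu'span
    rw [Submodule.mem_span_singleton]
    by_cases ha : a = 0
    · have hb : b ≠ 0 := by
        rintro rfl
        apply hu0
        funext j
        rw [hab j, ha]
        simp
      have hc : c = 0 := by
        have hbc : b * c = 0 := by linear_combination -hD0 + d * ha
        rcases mul_eq_zero.mp hbc with h | h
        · exact absurd h hb
        · exact h
      refine ⟨d / b, funext fun j => ?_⟩
      rw [Pi.smul_apply, smul_eq_mul, hab j, hcd j, ha, hc]
      field_simp
      ring
    · refine ⟨c / a, funext fun j => ?_⟩
      rw [Pi.smul_apply, smul_eq_mul, hab j, hcd j]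
      field_simp
      linear_combination (-(B j 1)) * hD0
  -- the sorted cross terms are `(ad - bc) · det(P_{α_i}, P_{α_j}) ≥ 0`
  have key : ∀ i j : Fin (n + 2), i < j →
      0 ≤ (a * d - b * c) * galeDet B (Tuple.sort (fun l => u' l / u l) i)
        (Tuple.sort (fun l => u' l / u l) j) := by
    intro i j hij
    rw [← cross_eq_det_mul_galeDet B a b c d hab hcd]
    exact cross_nonneg_of_sort hupos hij.le
  rcases lt_or_gt_of_ne hD0 with hneg | hpos
  · refine ⟨-1, Or.inr rfl, fun i j hij => ?_⟩
    have h := key i j hij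
    nlinarith
  · refine ⟨1, Or.inl rfl, fun i j hij => ?_⟩
    have h := key i j hij
    rw [one_mul]
    exact nonneg_of_mul_nonneg_right h hpos

end Literature.Computability.AlgebraicComplexity
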